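import Summits.AtomisticToContinuum.HydrodynamicLimit.Theorems.DensityCap.Negative.MollifiedDensity

/-!
# `DensityCap`: the order of limits (`N → ∞` at fixed `r`, then `r → 0`) is essential

Negative knowledge for the crux `JParityClosure.DensityCap` (stmt-AtomisticToContinuum-13082), from the standing
disprover's `Cruxes/DensityCap/Disproof.lean` §4 (cycle 1). Two natural strengthenings of the conclusion block are FALSE
already at global equilibrium (profiles `(1,1,0)`, tied constant state `(1,0,1)`, Alexander's flows) and `t = 0`:
* `not_densityCapSwapped` — `∃ N₀` chosen BEFORE `∀ r < r₀` ("`r → 0` at fixed large `N`");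
* `not_densityCapAllN` — the bound demanded for EVERY `N` (no `N₀`).
Mechanism (`capEvent_eq_univ_of_small_r`): read at the position of particle `0`, the mollified empirical density of
`N + 1` particles has an ATOM of height `3/(πr³(N+1))` (`DensityCapNegative.atom_le_mollDensity`), which exceeds
`ρ + η = 2` as soon as `4(N+1)r ≤ 1`; the overshoot event is then the whole phase space, of probability `1 > 1/2`.
Provers: every estimate must be made at fixed `r` with `N → ∞` first; there is no sure/pathwise cap on the mollified
density beyond the trivial `3/(πr³)` (`DensityCapNegative.mollDensity_le`) — the cap is an LLN-scale (`N r³ → ∞`)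
statement along the deterministic flow.
refuter-cdisprove-stmt-AtomisticToContinuum-13082-0.
-/

noncomputable section

namespace Summit.AtomisticToContinuum.HydrodynamicLimit.Theorems.DensityCapNegative

open MeasureTheory Filter Set Topology
open scoped ENNReal
open Literature.MathematicalPhysics.KineticTheory Literature.Analysis.FluidPDE
open Literature.Analysis.FunctionSpaces
open Summit.AtomisticToContinuum.HydrodynamicLimit.Theses.JParityClosure
open Summit.AtomisticToContinuum.HydrodynamicLimit.Theorems.PolynomialCompressionPDE (Flows flows_nonempty)

/-! ## §4 Natural strengthenings refuted: the order of limits -/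

/-- At FIXED particle number the overshoot event is SURE once `r` is small: for the constant density `1`, `η = 1`,
`r ≤ 1` and `4(N+1)r ≤ 1`, every configuration overshoots at the position of particle `0` at time `0`
(the atom `3/(π r³ (N+1)) > 2`). -/
theorem capEvent_eq_univ_of_small_r {σ : ℝ} (Φ : Flows σ) (N : ℕ) {r : ℝ} (hr : 0 < r) (hr1 : r ≤ 1)
    (hrN : 4 * ((N : ℝ) + 1) * r ≤ 1) {t : ℝ} (ht : 0 ≤ t) :
    capEvent Φ N (fun _ _ => (1 : ℝ)) t 1 r = univ := by
  refine Set.eq_univ_of_forall fun z => ⟨0, ⟨le_rfl, ht⟩, (((Φ N).flow 0 z) 0).1, ?_⟩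
  have hat := atom_le_mollDensity hr ((Φ N).flow 0 z) 0
  refine lt_of_lt_of_le ?_ hat
  have hcast : ((N + 1 : ℕ) : ℝ) = (N : ℝ) + 1 := by push_cast; ring
  rw [hcast, show ((N : ℝ) + 1)⁻¹ * (3 / (Real.pi * r ^ 3)) = 3 / (((N : ℝ) + 1) * (Real.pi * r ^ 3)) by
    field_simp, lt_div_iff₀ (by positivity)]
  have hr3 : r ^ 3 ≤ r := pow_le_of_le_one hr.le hr1 three_ne_zero
  have hπ := Real.pi_le_four
  have h2 : Real.pi * r ^ 3 ≤ 4 * r := by nlinarith [pow_nonneg hr.le 3]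
  have h3 : ((N : ℝ) + 1) * (Real.pi * r ^ 3) ≤ ((N : ℝ) + 1) * (4 * r) :=
    mul_le_mul_of_nonneg_left h2 (by positivity)
  nlinarith

/-- The conclusion block with the LIMITS SWAPPED: `N₀` chosen before `r` ("uniformly in `r < r₀`", i.e. `r → 0`
at fixed large `N` allowed). -/
def CapLimitSwapped (σ : ℝ) (a₀ : T3 → ℝ) (u₀ : T3 → V3) (θ₀ : T3 → ℝ) (Φ : Flows σ) (ρ : ℝ → T3 → ℝ)
    (t : ℝ) : Prop :=
  ∀ η δ : ℝ, 0 < η → 0 < δ → ∃ r₀ : ℝ, 0 < r₀ ∧ ∃ N₀ : ℕ, ∀ r : ℝ, 0 < r → r < r₀ → ∀ N : ℕ, N₀ ≤ N →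
    localGibbsLaw σ a₀ u₀ θ₀ N (Φ N) (capEvent Φ N ρ t η r) ≤ ENNReal.ofReal δ

/-- `DensityCap` with `∃ N₀` pulled in front of `∀ r < r₀` (all else verbatim). -/
def DensityCapSwapped : Prop :=
  ∀ (a₀ θ₀ : T3 → ℝ) (u₀ : T3 → V3), Continuous a₀ → Continuous θ₀ → Continuous u₀ →
    (∀ x, 0 < a₀ x) → (∀ x, 0 < θ₀ x) → ∃ σ₀ : ℝ, 0 < σ₀ ∧ ∀ σ : ℝ, 0 < σ → σ < σ₀ →
    ∀ (T : ℝ) (ρ θ : ℝ → T3 → ℝ) (u : ℝ → T3 → V3), IsHardSphereEulerSolution σ T ρ u θ →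
    ∀ Φ : Flows σ, TendstoHydroFieldsAt (fun N => localGibbsLaw σ a₀ u₀ θ₀ N (Φ N)) Φ ρ u θ 0 →
    ∀ t ∈ Ico 0 T, CapLimitSwapped σ a₀ u₀ θ₀ Φ ρ t

/-- **The order of limits is essential**: `¬ DensityCapSwapped`, already at global equilibrium and `t = 0`.
Witness: profiles `(1, 1, 0)`, the TIED constant state `(1, 0, 1)`, Alexander's flows, `η = 1`, `δ = 1/2`; given
`r₀, N₀` take `N = N₀` and `r = min (r₀/2) (1/(4(N₀+1)))`: the atom of particle `0` alone has height
`3/(π r³ (N₀+1)) > 2` (`capEvent_eq_univ_of_small_r`), so the event is sure. The mollified empirical density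
converges to the Euler density only for `N → ∞` at FIXED `r` (then `r → 0`); no statement uniform in `r ↓ 0` at
finite `N` can hold. -/
theorem not_densityCapSwapped : ¬ DensityCapSwapped := by
  intro h
  obtain ⟨σ₁, hσ₁, hσ₁2, H1⟩ := homogeneous_lln
  obtain ⟨σ₀, hσ₀, h⟩ := h (fun _ => 1) (fun _ => 1) (fun _ => 0) continuous_const continuous_const
    continuous_const (fun _ => one_pos) (fun _ => one_pos)
  obtain ⟨σ, hσ, hσ0, hσ1, hσ2⟩ := exists_sigma hσ₀ hσ₁ hσ₁2
  obtain ⟨Φ⟩ := flows_nonempty hσ hσ2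
  obtain ⟨hprob, hT⟩ := H1 σ hσ hσ1 Φ
  have hsol := constState_isSolution σ 1 (c := 1) (θc := 1) one_pos one_pos
  obtain ⟨r₀, hr₀, N₀, hr⟩ := h σ hσ hσ0 1 _ _ _ hsol Φ hT 0 ⟨le_rfl, one_pos⟩ 1 (1 / 2) one_pos
    (by norm_num)
  set r : ℝ := min (r₀ / 2) (1 / (4 * ((N₀ : ℝ) + 1))) with hrdef
  have hrpos : 0 < r := lt_min (by linarith) (by positivity)
  have hrlt : r < r₀ := lt_of_le_of_lt (min_le_left _ _) (by linarith)
  have hrN : 4 * ((N₀ : ℝ) + 1) * r ≤ 1 := by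
    have h1 : r ≤ 1 / (4 * ((N₀ : ℝ) + 1)) := min_le_right _ _
    rw [le_div_iff₀ (by positivity)] at h1
    linarith
  have hr1 : r ≤ 1 := by nlinarith [(Nat.cast_nonneg N₀ : (0 : ℝ) ≤ N₀)]
  haveI := hprob N₀
  exact not_univ_le _ (by norm_num : (1 : ℝ) / 2 < 1) (capEvent_eq_univ_of_small_r Φ N₀ hrpos hr1 hrN le_rfl)
    (hr r hrpos hrlt N₀ le_rfl)

/-- The conclusion block demanded for EVERY particle number (no `N₀`). -/
def CapLimitAllN (σ : ℝ) (a₀ : T3 → ℝ) (u₀ : T3 → V3) (θ₀ : T3 → ℝ) (Φ : Flows σ) (ρ : ℝ → T3 → ℝ)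
    (t : ℝ) : Prop :=
  ∀ η δ : ℝ, 0 < η → 0 < δ → ∃ r₀ : ℝ, 0 < r₀ ∧ ∀ r : ℝ, 0 < r → r < r₀ → ∀ N : ℕ,
    localGibbsLaw σ a₀ u₀ θ₀ N (Φ N) (capEvent Φ N ρ t η r) ≤ ENNReal.ofReal δ

/-- `DensityCap` with `∃ N₀, ∀ N ≥ N₀` replaced by `∀ N` (all else verbatim). -/
def DensityCapAllN : Prop :=
  ∀ (a₀ θ₀ : T3 → ℝ) (u₀ : T3 → V3), Continuous a₀ → Continuous θ₀ → Continuous u₀ →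
    (∀ x, 0 < a₀ x) → (∀ x, 0 < θ₀ x) → ∃ σ₀ : ℝ, 0 < σ₀ ∧ ∀ σ : ℝ, 0 < σ → σ < σ₀ →
    ∀ (T : ℝ) (ρ θ : ℝ → T3 → ℝ) (u : ℝ → T3 → V3), IsHardSphereEulerSolution σ T ρ u θ →
    ∀ Φ : Flows σ, TendstoHydroFieldsAt (fun N => localGibbsLaw σ a₀ u₀ θ₀ N (Φ N)) Φ ρ u θ 0 →
    ∀ t ∈ Ico 0 T, CapLimitAllN σ a₀ u₀ θ₀ Φ ρ t

/-- **`N → ∞` cannot be dropped**: `¬ DensityCapAllN` (one sphere, `N = 0`: its atom has height `3/(π r³) > 2` for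
`r ≤ 1/4`). -/
theorem not_densityCapAllN : ¬ DensityCapAllN := by
  intro h
  obtain ⟨σ₁, hσ₁, hσ₁2, H1⟩ := homogeneous_lln
  obtain ⟨σ₀, hσ₀, h⟩ := h (fun _ => 1) (fun _ => 1) (fun _ => 0) continuous_const continuous_const
    continuous_const (fun _ => one_pos) (fun _ => one_pos)
  obtain ⟨σ, hσ, hσ0, hσ1, hσ2⟩ := exists_sigma hσ₀ hσ₁ hσ₁2
  obtain ⟨Φ⟩ := flows_nonempty hσ hσ2
  obtain ⟨hprob, hT⟩ := H1 σ hσ hσ1 Φ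
  have hsol := constState_isSolution σ 1 (c := 1) (θc := 1) one_pos one_pos
  obtain ⟨r₀, hr₀, hr⟩ := h σ hσ hσ0 1 _ _ _ hsol Φ hT 0 ⟨le_rfl, one_pos⟩ 1 (1 / 2) one_pos (by norm_num)
  set r : ℝ := min (r₀ / 2) (1 / 4) with hrdef
  have hrpos : 0 < r := lt_min (by linarith) (by norm_num)
  have hrlt : r < r₀ := lt_of_le_of_lt (min_le_left _ _) (by linarith)
  have hr4 : r ≤ 1 / 4 := min_le_right _ _
  haveI := hprob 0
  exact not_univ_le _ (by norm_num : (1 : ℝ) / 2 < 1)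
    (capEvent_eq_univ_of_small_r Φ 0 hrpos (by linarith) (by push_cast; linarith) le_rfl) (hr r hrpos hrlt 0)


end Summit.AtomisticToContinuum.HydrodynamicLimit.Theorems.DensityCapNegative

end
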